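import Summits.QuantumFields.BalabanUV.Beta.GAN24.FaceWWordLetters

/-!
# GAN24 ∕ PART VI ∕ T6-STEP SUPPLIER — Part 50a: the W-letter face word is absolutely summable in the free bond

[folklore] bookkeeping of the crux team's leaf 02 (road-P2's forcing frame, hypothesis `hW0` of Part 49
`ForcingFacePairFormGlue.pairFormLS_of_threeWords`).  For the symmetrised second-order carrier with vanishing second field
partials, `W̃ := W2SymOfK K N S M 0 M₂`, pointwise

  `W̃ μ y ν y′ = mixOfK μ y ν y′ + mixOfK ν y′ μ y + ½·(dM (K2OfK ν y′) μ y + dM (K2OfK μ y) ν y′)`      (§1),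

every piece is bi-localised with a constant decaying in `|N•y − N•y′|` (§2: `FaceWWordLetters.biLoc_mixOfK_far` for the mixed
pieces, `biLoc_resp_far` for the response pieces), so the face-masked leg pair of `W̃ μ y ν u′` is bounded by `A·e^{−(m/8)|N•y − N•u′|}`
and the free-bond series of the W face word converges absolutely (§3, `summable_faceWord_W2SymOfK_zero₂`); Part 50b
`FaceWWordVanishing` uses the splitting `tsum_facePair_W2SymOfK_zero₂` and the four free-bond summabilities to show that the
leg-symmetrised W face word of the dressed step vanishes (hypothesis `hW0` of Part 49).

HONEST: NOT IN PRINT; nothing of `(C)_{≥1}` ∕ `hBF` is discharged here; NOT D1, NOT `BetaPertH`, NOT continuum, NOT Clay.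
-/

noncomputable section

open Finset
open scoped BigOperators
open Literature.MathematicalPhysics.QuantumFieldTheory
open Literature.MathematicalPhysics.QuantumFieldTheory.Balaban1983to89
open Literature.MathematicalPhysics.QuantumFieldTheory.Balaban1983to89.Beta
open B12Sec2to5 (l1 l1_nonneg)
open ExpKernelCalculus (Site MKer Decays BiLoc VertexFamily VertexFamily₂ shiftK l1_sub_symm Zl Zl_pos Zl_nonneg)
open OneStepResolventKernel (Fib LocStencil biLoc_mono)
open AffineAveraging (box toSite)
open OneStepKernelFamily (KInvStep decays_KInvStep vertexOfK)
open SecondOrderResponse (vertexOfM dM K2OfK mixOfK vertex2OfK W2OfK W2OfK_apply W2SymOfK LocStencilFM cK2 vertexFamily_K2OfK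
  vertexFamily₂_resp vertexFamily₂_mixOfK biLoc_vertexOfK_of_biLoc biLoc_vertexOfM_of_biLoc)
open BalabanStepJets (locStencil_mono)
open BalabanStepW2 (vertexFamily_mono')
open Summit.QuantumFields.BalabanUV.Beta.TameKernelCalculus (trK)
open Summit.QuantumFields.BalabanUV.Beta.BorderedHessian (sgnK)
open Summit.QuantumFields.BalabanUV.Beta.AxialDressingRooted (coDressKBmAt decays_coDressKBmAt)
open Summit.QuantumFields.BalabanUV.Beta.HessKerDressedUnits (unitK decays_unitK)
open Summit.QuantumFields.BalabanUV.Beta.GAN24.PairingCellTransfer (summable_facePair abs_tsum_facePair_le)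
open Summit.QuantumFields.BalabanUV.Beta.GAN24.FaceWWordLetters (biLoc_mixOfK_far locStencilFM_mono resp_facePair_swap
  tsum_faceBond_mixWord_eq_zero sum_box_tsum_mixWord_swap_eq_zero)

namespace Summit.QuantumFields.BalabanUV.Beta.GAN24.FaceWWordSummable

variable {d : ℕ}

/-! ## §1 The symmetrised carrier with vanishing second field partials, pointwise -/

/-- [folklore] The field-column vertex of the zero table is the zero kernel (cf. `T2RecursionAffine.vertexOfK_zero_table`). -/
theorem vertexOfK_zero_table' (K : MKer (d + 1) (Fib d)) (N : ℕ) (ν : Fin (d + 1)) (y' : Fin (d + 1) → ℤ) :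
    vertexOfK K N (0 : Fin (d + 1) → (Fin (d + 1) → ℤ) → MKer (d + 1) (Fib d)) ν y' = 0 := by
  funext x z a b
  simp only [vertexOfK, OneStepResolventKernel.wsum, Pi.zero_apply, mul_zero, tsum_zero, Finset.sum_const_zero]

/-- [folklore] The bi-vertex of the zero bi-stencil table is the zero kernel (cf. `T2RecursionAffine.vertex2OfK_zero`). -/
theorem vertex2OfK_zero' (K : MKer (d + 1) (Fib d)) (N : ℕ) (μ : Fin (d + 1)) (y : Fin (d + 1) → ℤ) (ν : Fin (d + 1)) (y' : Fin (d + 1) → ℤ) :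
    vertex2OfK K N (0 : Fin (d + 1) → (Fin (d + 1) → ℤ) → Fin (d + 1) → (Fin (d + 1) → ℤ) → MKer (d + 1) (Fib d)) μ y ν y' = 0 := by
  unfold vertex2OfK
  have h : (fun κ u => vertexOfK K N ((0 : Fin (d + 1) → (Fin (d + 1) → ℤ) → Fin (d + 1) → (Fin (d + 1) → ℤ) →
      MKer (d + 1) (Fib d)) κ u) ν y') = (0 : Fin (d + 1) → (Fin (d + 1) → ℤ) → MKer (d + 1) (Fib d)) := by
    funext κ u
    simp only [Pi.zero_apply]
    exact vertexOfK_zero_table' K N ν y'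
  rw [h]
  exact vertexOfK_zero_table' K N μ y

/-- [folklore] `W2SymOfK K N S M 0 M₂ μ y ν y′ = mixOfK μ y ν y′ + mixOfK ν y′ μ y + ½·(dM (K2OfK ν y′) μ y + dM (K2OfK μ y) ν y′)` entrywise
(`W2OfK_apply` twice, `vertex2OfK_zero`). -/
theorem W2SymOfK_zero₂_apply (K : MKer (d + 1) (Fib d)) (N : ℕ) (S M : Fin (d + 1) → (Fin (d + 1) → ℤ) → MKer (d + 1) (Fib d))
    (M₂ : Fin (d + 1) → (Fin (d + 1) → ℤ) → Fin (d + 1) → (Fin (d + 1) → ℤ) → MKer (d + 1) (Fib d))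
    (μ : Fin (d + 1)) (y : Fin (d + 1) → ℤ) (ν : Fin (d + 1)) (y' : Fin (d + 1) → ℤ) (x z : Site (d + 1)) (a b : Fib d) :
    W2SymOfK K N S M 0 M₂ μ y ν y' x z a b
      = mixOfK K N M₂ μ y ν y' x z a b + mixOfK K N M₂ ν y' μ y x z a b
        + (1 / 2 : ℝ) * (dM (K2OfK K N S M ν y') N S M μ y x z a b + dM (K2OfK K N S M μ y) N S M ν y' x z a b) := by
  simp only [W2SymOfK, W2OfK_apply, vertex2OfK_zero', Pi.add_apply, Pi.smul_apply, smul_eq_mul, zero_add]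
  ring

/-! ## §2 Far bi-localisation of the response pieces -/

section Far

variable {N : ℕ} [NeZero N] {K : MKer (d + 1) (Fib d)} {C m : ℝ}
  {S M : Fin (d + 1) → (Fin (d + 1) → ℤ) → MKer (d + 1) (Fib d)} {Cs CM : ℝ}

/-- [folklore] **THE RESPONSE PIECE IS FAR-CENTRED**: `dM (K2OfK K N S M ν y′) N S M μ y` is bi-localised at `(N•y′, N•y′)` with a constant
decaying like `e^{−(m/8)|N•y − N•y′|}` (`vertexFamily_K2OfK` + `biLoc_vertexOfK_of_biLoc` ∕ `biLoc_vertexOfM_of_biLoc`). -/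
theorem biLoc_resp_far (hK : Decays K C m) (hC : 0 ≤ C) (hm : 0 < m) (hS : LocStencil S Cs m) (hM : VertexFamily M N CM m)
    (μ : Fin (d + 1)) (y : Fin (d + 1) → ℤ) (ν : Fin (d + 1)) (y' : Fin (d + 1) → ℤ) :
    BiLoc (dM (K2OfK K N S M ν y') N S M μ y) ((N : ℤ) • y') ((N : ℤ) • y')
      (((d + 1 : ℕ) * (cK2 d C Cs CM m * Cs * Zl (d + 1) (m / 8 / 2)) + (d + 1 : ℕ) * (cK2 d C Cs CM m * CM * Zl (d + 1) (m / 8 / 2)))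
        * Real.exp (-(m / 8) * l1 ((N : ℤ) • y - (N : ℤ) • y'))) (m / 8 / 2) := by
  have hCs : 0 ≤ Cs := (hS 0 0).nonneg (Sum.inl 0)
  have hCM : 0 ≤ CM := (hM 0 0).nonneg (Sum.inl 0)
  have hK2 := vertexFamily_K2OfK (N := N) hK hC hm hS hM
  have hm8 : 0 < m / 8 := by positivity
  have hS8 : LocStencil S Cs (m / 8) := locStencil_mono hS hCs (by linarith)
  have hM8 : VertexFamily M N CM (m / 8) := vertexFamily_mono' hM hCM (by linarith)
  have h := KernelWard.biLoc_add (biLoc_vertexOfK_of_biLoc (N := N) (hK2 ν y') hS8 hm8 μ y)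
    (biLoc_vertexOfM_of_biLoc (N := N) (hK2 ν y') hM8 hm8 μ y)
  have e : (d + 1 : ℕ) * (cK2 d C Cs CM m * Real.exp (-(m / 8) * l1 ((N : ℤ) • y - (N : ℤ) • y')) * Cs * Zl (d + 1) (m / 8 / 2))
      + (d + 1 : ℕ) * (cK2 d C Cs CM m * Real.exp (-(m / 8) * l1 ((N : ℤ) • y - (N : ℤ) • y')) * CM * Zl (d + 1) (m / 8 / 2))
      = (((d + 1 : ℕ) * (cK2 d C Cs CM m * Cs * Zl (d + 1) (m / 8 / 2)) + (d + 1 : ℕ) * (cK2 d C Cs CM m * CM * Zl (d + 1) (m / 8 / 2)))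
        * Real.exp (-(m / 8) * l1 ((N : ℤ) • y - (N : ℤ) • y'))) := by ring
  rw [e] at h
  exact h

/-- [folklore] `biLoc_resp_far` for the piece with the two bonds exchanged, re-expressed with `|N•y − N•y′|`. -/
theorem biLoc_resp_far_swap (hK : Decays K C m) (hC : 0 ≤ C) (hm : 0 < m) (hS : LocStencil S Cs m) (hM : VertexFamily M N CM m)
    (μ : Fin (d + 1)) (y : Fin (d + 1) → ℤ) (ν : Fin (d + 1)) (y' : Fin (d + 1) → ℤ) :
    BiLoc (dM (K2OfK K N S M μ y) N S M ν y') ((N : ℤ) • y) ((N : ℤ) • y)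
      (((d + 1 : ℕ) * (cK2 d C Cs CM m * Cs * Zl (d + 1) (m / 8 / 2)) + (d + 1 : ℕ) * (cK2 d C Cs CM m * CM * Zl (d + 1) (m / 8 / 2)))
        * Real.exp (-(m / 8) * l1 ((N : ℤ) • y - (N : ℤ) • y'))) (m / 8 / 2) := by
  have h := biLoc_resp_far (N := N) hK hC hm hS hM ν y' μ y
  rw [l1_sub_symm] at h
  exact h

variable {M₂ : Fin (d + 1) → (Fin (d + 1) → ℤ) → Fin (d + 1) → (Fin (d + 1) → ℤ) → MKer (d + 1) (Fib d)} {C₂ : ℝ}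

/-- [folklore] `FaceWWordLetters.biLoc_mixOfK_far` with the constant displayed as `C₀ · e^{−(m/8)|N•y − N•y′|}`. -/
theorem biLoc_mixOfK_far' (hK : Decays K C m) (hC : 0 ≤ C) (hM₂ : LocStencilFM N M₂ C₂ m) (hm : 0 < m)
    (μ : Fin (d + 1)) (y : Fin (d + 1) → ℤ) (ν : Fin (d + 1)) (y' : Fin (d + 1) → ℤ) :
    BiLoc (mixOfK K N M₂ μ y ν y') ((N : ℤ) • y) ((N : ℤ) • y)
      (((d + 1 : ℕ) * (C * ((d + 1 : ℕ) * (C * C₂ * Zl (d + 1) (m / 2))) * Zl (d + 1) (m / 2 / 4)))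
        * Real.exp (-(m / 2 / 4) * l1 ((N : ℤ) • y - (N : ℤ) • y'))) (m / 2 / 4) := by
  have h := biLoc_mixOfK_far (N := N) hK hC hM₂ hm μ y ν y'
  have e : (d + 1 : ℕ) * (C * ((d + 1 : ℕ) * (C * C₂ * Zl (d + 1) (m / 2))) * Zl (d + 1) (m / 2 / 4)
      * Real.exp (-(m / 2 / 4) * l1 ((N : ℤ) • y - (N : ℤ) • y')))
      = (((d + 1 : ℕ) * (C * ((d + 1 : ℕ) * (C * C₂ * Zl (d + 1) (m / 2))) * Zl (d + 1) (m / 2 / 4)))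
        * Real.exp (-(m / 2 / 4) * l1 ((N : ℤ) • y - (N : ℤ) • y'))) := by ring
  rw [e] at h
  exact h

/-- [folklore] … and for the mixed piece with the two bonds exchanged. -/
theorem biLoc_mixOfK_far_swap (hK : Decays K C m) (hC : 0 ≤ C) (hM₂ : LocStencilFM N M₂ C₂ m) (hm : 0 < m)
    (μ : Fin (d + 1)) (y : Fin (d + 1) → ℤ) (ν : Fin (d + 1)) (y' : Fin (d + 1) → ℤ) :
    BiLoc (mixOfK K N M₂ ν y' μ y) ((N : ℤ) • y') ((N : ℤ) • y')
      (((d + 1 : ℕ) * (C * ((d + 1 : ℕ) * (C * C₂ * Zl (d + 1) (m / 2))) * Zl (d + 1) (m / 2 / 4)))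
        * Real.exp (-(m / 2 / 4) * l1 ((N : ℤ) • y - (N : ℤ) • y'))) (m / 2 / 4) := by
  have h := biLoc_mixOfK_far' (N := N) hK hC hM₂ hm ν y' μ y
  rw [l1_sub_symm] at h
  exact h

end Far

/-! ## §3 The face-masked leg pair of `W̃ μ y ν u′`: bound and free-bond summability -/

section PairWord

variable {N : ℕ} [NeZero N] {K : MKer (d + 1) (Fib d)} {C m : ℝ}
  {S M : Fin (d + 1) → (Fin (d + 1) → ℤ) → MKer (d + 1) (Fib d)} {Cs CM : ℝ}
  {M₂ : Fin (d + 1) → (Fin (d + 1) → ℤ) → Fin (d + 1) → (Fin (d + 1) → ℤ) → MKer (d + 1) (Fib d)} {C₂ : ℝ}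

omit [NeZero N] in
/-- [folklore] A far-centred bi-localised family has a face-masked leg pair bounded by its far constant (`abs_tsum_facePair_le`), hence a
weighted free-bond series that converges absolutely (`KernelLegCharges.summable_exp_coarse`). -/
theorem summable_pairWord_far (hN : 1 ≤ N) {V : Site (d + 1) → MKer (d + 1) (Fib d)} {p q : Site (d + 1) → Site (d + 1)} {C₀ δ δ' : ℝ}
    (hδ : 0 < δ) (hδ' : 0 < δ') (y : Site (d + 1))
    (hV : ∀ u', BiLoc (V u') (p u') (q u') (C₀ * Real.exp (-δ' * l1 ((N : ℤ) • y - (N : ℤ) • u'))) δ)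
    (f : Site (d + 1) → ℝ) {B : ℝ} (hf : ∀ u', |f u'| ≤ B) (NL : ℤ) (α β : Fin (d + 1)) (a b : Fib d) :
    Summable fun u' : Site (d + 1) => f u' * ∑' yw : Site (d + 1) × Site (d + 1),
      (if yw.1 α % NL = NL - 1 then (1 : ℝ) else 0) * (if yw.2 β % NL = NL - 1 then (1 : ℝ) else 0) * V u' yw.1 yw.2 a b := by
  have hg : Summable fun u' : Site (d + 1) => Real.exp (-δ' * l1 ((N : ℤ) • y - (N : ℤ) • u')) :=
    (KernelLegCharges.summable_exp_coarse hN hδ' ((N : ℤ) • y)).congr fun u' => by rw [l1_sub_symm]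
  refine Summable.of_norm_bounded (hg.mul_left (B * (C₀ * (Zl (d + 1) δ * Zl (d + 1) δ)))) (fun u' => ?_)
  rw [Real.norm_eq_abs, abs_mul]
  have h1 := abs_tsum_facePair_le (hV u') hδ NL α β a b
  have hB : 0 ≤ B := (abs_nonneg _).trans (hf u')
  have hZ : 0 ≤ Zl (d + 1) δ * Zl (d + 1) δ := mul_nonneg (Zl_nonneg hδ) (Zl_nonneg hδ)
  calc |f u'| * |∑' yw : Site (d + 1) × Site (d + 1), (if yw.1 α % NL = NL - 1 then (1 : ℝ) else 0) * (if yw.2 β % NL = NL - 1 then (1 : ℝ) else 0) *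
          V u' yw.1 yw.2 a b|
      ≤ B * (C₀ * Real.exp (-δ' * l1 ((N : ℤ) • y - (N : ℤ) • u')) * (Zl (d + 1) δ * Zl (d + 1) δ)) :=
        mul_le_mul (hf u') h1 (abs_nonneg _) hB
    _ = B * (C₀ * (Zl (d + 1) δ * Zl (d + 1) δ)) * Real.exp (-δ' * l1 ((N : ℤ) • y - (N : ℤ) • u')) := by ring

/-- [folklore] **THE FACE-MASKED LEG PAIR OF THE SYMMETRISED CARRIER SPLITS INTO ITS FOUR PIECES** (each piece is bi-localised, so each masked
pair series converges: `summable_facePair`). -/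
theorem tsum_facePair_W2SymOfK_zero₂ (hK : Decays K C m) (hC : 0 ≤ C) (hm : 0 < m) (hS : LocStencil S Cs m) (hM : VertexFamily M N CM m)
    (hM₂ : LocStencilFM N M₂ C₂ m) (μ : Fin (d + 1)) (y : Fin (d + 1) → ℤ) (ν : Fin (d + 1)) (y' : Fin (d + 1) → ℤ) (NL : ℤ)
    (α β : Fin (d + 1)) (a b : Fib d) :
    ∑' yw : Site (d + 1) × Site (d + 1), (if yw.1 α % NL = NL - 1 then (1 : ℝ) else 0) * (if yw.2 β % NL = NL - 1 then (1 : ℝ) else 0) *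
        W2SymOfK K N S M 0 M₂ μ y ν y' yw.1 yw.2 a b
      = (∑' yw : Site (d + 1) × Site (d + 1), (if yw.1 α % NL = NL - 1 then (1 : ℝ) else 0) * (if yw.2 β % NL = NL - 1 then (1 : ℝ) else 0) *
          mixOfK K N M₂ μ y ν y' yw.1 yw.2 a b)
        + (∑' yw : Site (d + 1) × Site (d + 1), (if yw.1 α % NL = NL - 1 then (1 : ℝ) else 0) * (if yw.2 β % NL = NL - 1 then (1 : ℝ) else 0) *
          mixOfK K N M₂ ν y' μ y yw.1 yw.2 a b)
        + (1 / 2 : ℝ) * ((∑' yw : Site (d + 1) × Site (d + 1), (if yw.1 α % NL = NL - 1 then (1 : ℝ) else 0) * (if yw.2 β % NL = NL - 1 then (1 : ℝ) else 0) *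
            dM (K2OfK K N S M ν y') N S M μ y yw.1 yw.2 a b)
          + (∑' yw : Site (d + 1) × Site (d + 1), (if yw.1 α % NL = NL - 1 then (1 : ℝ) else 0) * (if yw.2 β % NL = NL - 1 then (1 : ℝ) else 0) *
            dM (K2OfK K N S M μ y) N S M ν y' yw.1 yw.2 a b)) := by
  have hm8 : 0 < m / 8 := by positivity
  have hm82 : 0 < m / 8 / 2 := by positivity
  have h1 := summable_facePair (vertexFamily₂_mixOfK (N := N) hK hC hM₂ hm μ y ν y') hm8 NL α β a b
  have h2 := summable_facePair (vertexFamily₂_mixOfK (N := N) hK hC hM₂ hm ν y' μ y) hm8 NL α β a b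
  have h3 := summable_facePair (biLoc_resp_far (N := N) hK hC hm hS hM μ y ν y') hm82 NL α β a b
  have h4 := summable_facePair (biLoc_resp_far (N := N) hK hC hm hS hM ν y' μ y) hm82 NL α β a b
  have hpt : ∀ yw : Site (d + 1) × Site (d + 1),
      (if yw.1 α % NL = NL - 1 then (1 : ℝ) else 0) * (if yw.2 β % NL = NL - 1 then (1 : ℝ) else 0) * W2SymOfK K N S M 0 M₂ μ y ν y' yw.1 yw.2 a b
        = ((if yw.1 α % NL = NL - 1 then (1 : ℝ) else 0) * (if yw.2 β % NL = NL - 1 then (1 : ℝ) else 0) * mixOfK K N M₂ μ y ν y' yw.1 yw.2 a b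
          + (if yw.1 α % NL = NL - 1 then (1 : ℝ) else 0) * (if yw.2 β % NL = NL - 1 then (1 : ℝ) else 0) * mixOfK K N M₂ ν y' μ y yw.1 yw.2 a b)
          + (1 / 2 : ℝ) * ((if yw.1 α % NL = NL - 1 then (1 : ℝ) else 0) * (if yw.2 β % NL = NL - 1 then (1 : ℝ) else 0) *
              dM (K2OfK K N S M ν y') N S M μ y yw.1 yw.2 a b
            + (if yw.1 α % NL = NL - 1 then (1 : ℝ) else 0) * (if yw.2 β % NL = NL - 1 then (1 : ℝ) else 0) *
              dM (K2OfK K N S M μ y) N S M ν y' yw.1 yw.2 a b) := by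
    intro yw; rw [W2SymOfK_zero₂_apply]; ring
  simp only [hpt]
  rw [(h1.add h2).tsum_add ((h3.add h4).mul_left _), h1.tsum_add h2, tsum_mul_left, h3.tsum_add h4]

/-- [folklore] **THE W FACE WORD IS ABSOLUTELY SUMMABLE IN THE FREE BOND**: for any bounded bond weight `f` and any leg modulus, the series
`u′ ↦ f u′ · Σ'_{(x,z)} [x_α][z_β]·W̃ μ y ν u′ x z a b` converges (`W̃ = W2SymOfK K N S M 0 M₂`; the four pieces are far-centred, §2). -/
theorem summable_faceWord_W2SymOfK_zero₂ (hN : 1 ≤ N) (hK : Decays K C m) (hC : 0 ≤ C) (hm : 0 < m) (hS : LocStencil S Cs m)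
    (hM : VertexFamily M N CM m) (hM₂ : LocStencilFM N M₂ C₂ m) (μ : Fin (d + 1)) (y : Fin (d + 1) → ℤ) (ν : Fin (d + 1))
    (f : Site (d + 1) → ℝ) {B : ℝ} (hf : ∀ u', |f u'| ≤ B) (NL : ℤ) (α β : Fin (d + 1)) (a b : Fib d) :
    Summable fun u' : Site (d + 1) => f u' * ∑' yw : Site (d + 1) × Site (d + 1),
      (if yw.1 α % NL = NL - 1 then (1 : ℝ) else 0) * (if yw.2 β % NL = NL - 1 then (1 : ℝ) else 0) * W2SymOfK K N S M 0 M₂ μ y ν u' yw.1 yw.2 a b := by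
  have hm8 : 0 < m / 8 := by positivity
  have hm82 : 0 < m / 8 / 2 := by positivity
  have hm24 : 0 < m / 2 / 4 := by positivity
  -- the four far-centred pieces
  have s1 := summable_pairWord_far (N := N) hN hm24 hm24 y (fun u' => biLoc_mixOfK_far' (N := N) hK hC hM₂ hm μ y ν u') f hf NL α β a b
  have s2 := summable_pairWord_far (N := N) hN hm24 hm24 y (fun u' => biLoc_mixOfK_far_swap (N := N) hK hC hM₂ hm μ y ν u') f hf NL α β a b
  have s3 := summable_pairWord_far (N := N) hN hm82 hm8 y (fun u' => biLoc_resp_far (N := N) hK hC hm hS hM μ y ν u') f hf NL α β a b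
  have s4 := summable_pairWord_far (N := N) hN hm82 hm8 y (fun u' => biLoc_resp_far_swap (N := N) hK hC hm hS hM μ y ν u') f hf NL α β a b
  have h := (s1.add s2).add ((s3.add s4).mul_left (1 / 2 : ℝ))
  refine h.congr fun u' => ?_
  rw [tsum_facePair_W2SymOfK_zero₂ (N := N) hK hC hm hS hM hM₂ μ y ν u' NL α β a b]
  ring

end PairWord

end Summit.QuantumFields.BalabanUV.Beta.GAN24.FaceWWordSummable

end
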